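import Summits.BirchSwinnertonDyer.BirchSwinnertonDyer.Theorems.TwistFamilyManinDescentIsogenyTableFamilyEngineTwo
import HarnessLib

/-!
# Route `TwistFamilyManinDescent`, crux `IsogenyTableFamiliesManinOne` (stmt-BirchSwinnertonDyer-25137): the `j(−163)`
# family `j = −640320³` under the item's clause `2⁶ ∤ N(W)` — ODD inner twists only (base 26569a1, `2⁴·163² = 425104`)

THEOREMS ONLY, no route file imported (`--supports` 25137).
* `conductorExponent_two_quadraticTwist_le_four_of_odd` — `W` semistable at `2`, `d` odd square-free ⇒ `f₂(W ⊗ d) ≤ 4`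
  (`d ≡ 3 (4)`: Barrios et al. Thm 5.1 gives `4`; `d ≡ 1 (4)`: unramified twist model, `f₂` unchanged).
* `conductorExponent_two_quadraticTwist_eq_six_of_two_dvd` — `W` semistable at `2`, `d₀` square-free EVEN, `d₁` odd ⇒
  `f₂(W ⊗ d₀d₁) = 6`.
* `classAbsManinConstantEqOne_of_j_eq_of_odd_certificates` — the `j`-family reduction of
  `…IsogenyTableFamiliesReduction` with the parity threaded: if `2⁶ ∤ N(W)` and `f₂(E₀) ≤ 1`, the square-free part
  `d₀` of the twisting parameter on `{2} ∪ S` is ODD (an even one would force `f₂(W) = 6`), so certificates are needed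
  only for the odd `d₀`.
* `classAbsManinConstantEqOne_of_j_eq_neg_640320_cube` — the family `j = −640320³ = −262537412640768000` with
  `2⁶ ∤ N(W)`, base `26569a1 = [0,0,1,−2174420,1234136692]` (`Δ = −163³`, good at `2`), odd twists `d₀ ∈ ±{1,163}`
  certified by Cremona through `N ∣ 2⁴·163² = 425104 < 5·10⁵`.
Nothing about BSD is proved; Manin's conjecture is not proved.
-/

-- D-0017: single-problem summit, so `Summit.BirchSwinnertonDyer.BirchSwinnertonDyer.…` repeats a namespace BY DESIGN.
set_option linter.dupNamespace false
set_option autoImplicit false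

noncomputable section

open scoped Classical

open WeierstrassCurve IsDedekindDomain Rat.HeightOneSpectrum
  Literature.NumberTheory.EllipticCurves Literature.NumberTheory.EllipticCurves.ModularForms

namespace Summit.BirchSwinnertonDyer.BirchSwinnertonDyer.Theorems.TwistFamilyManinDescent

/-- **`f₂(W ⊗ d) ≤ 4` for `W` semistable at `2` and `d` ODD square-free.** [cite: BarriosEtAl2025, Thm. 5.1] -/
theorem conductorExponent_two_quadraticTwist_le_four_of_odd (W : WeierstrassCurve ℚ) [W.IsElliptic]
    (v : HeightOneSpectrum ℤ) (hv : natGenerator v = 2) (hf : W.conductorExponent v ≤ 1)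
    {d : ℤ} (hd0 : d ≠ 0) (hodd : ¬ (2 : ℤ) ∣ d) : (W.quadraticTwist (d : ℚ)).conductorExponent v ≤ 4 := by
  haveI : PerfectField (IsLocalRing.ResidueField (v.adicCompletionIntegers ℚ)) := PerfectField.ofFinite
  have hdq : (d : ℚ) ≠ 0 := by exact_mod_cast hd0
  haveI := W.isElliptic_quadraticTwist hdq
  have key := BarriosEtAl2025.conductorExponent_quadraticTwist_two_of_le_one_holds W v hv hf d
  have hlt : d % 4 < 4 := Int.emod_lt_of_pos d (by norm_num)
  have hge : 0 ≤ d % 4 := Int.emod_nonneg d (by norm_num)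
  have hcases : d % 4 = 1 ∨ d % 4 = 3 := by omega
  rcases hcases with h1 | h3
  · set k : ℤ := d / 4 with hk
    have hkd : 4 * k + 1 = d := by have := Int.emod_add_mul_ediv d 4; omega
    have hkq : (4 * (k : ℚ) + 1) = (d : ℚ) := by exact_mod_cast hkd
    obtain ⟨C, -, hC⟩ := exists_variableChange_twistModel_eq_quadraticTwist W (k : ℚ)
    rw [hkq] at hC
    haveI : (W.twistModel (k : ℚ)).IsElliptic := by
      refine ⟨?_⟩
      rw [twistModel_Δ, hkq]
      exact (IsUnit.mk0 _ (pow_ne_zero 6 hdq)).mul W.isUnit_Δ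
    rw [← hC, conductorExponent_smul' v _ C]
    have h2d : ¬ ((natGenerator v : ℕ) : ℤ) ∣ 4 * k + 1 := by rw [hv]; push_cast; omega
    rw [conductorExponent_twistModel v W
      (by rw [show (k : ℚ) = algebraMap ℤ ℚ k from (eq_intCast _ k).symm]
          exact HeightOneSpectrum.valuation_le_one v k)
      (by rw [show (4 * (k : ℚ) + 1 : ℚ) = ((4 * k + 1 : ℤ) : ℚ) by push_cast; ring,
            Literature.NumberTheory.EllipticCurves.Rat.valuation_intCast_eq_one_iff]
          exact h2d)]
    omega
  · rw [key.1 h3]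

/-- **`f₂(W ⊗ d₀d₁) = 6` for `W` semistable at `2`, `d₀` square-free and EVEN, `d₁` odd.**
[cite: BarriosEtAl2025, Thm. 5.1] -/
theorem conductorExponent_two_quadraticTwist_eq_six_of_two_dvd (W : WeierstrassCurve ℚ) [W.IsElliptic]
    (v : HeightOneSpectrum ℤ) (hv : natGenerator v = 2) (hf : W.conductorExponent v ≤ 1)
    {d₀ d₁ : ℤ} (hsq : Squarefree d₀) (h2 : (2 : ℤ) ∣ d₀) (hodd : ¬ (2 : ℤ) ∣ d₁) :
    (W.quadraticTwist ((d₀ * d₁ : ℤ) : ℚ)).conductorExponent v = 6 := by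
  have key := BarriosEtAl2025.conductorExponent_quadraticTwist_two_of_le_one_holds W v hv hf (d₀ * d₁)
  have h4 : ¬ (4 : ℤ) ∣ d₀ := fun h ↦ by
    have h22 : (2 : ℤ) * 2 ∣ d₀ := by norm_num; exact h
    have hu := hsq 2 h22
    rw [Int.isUnit_iff] at hu
    omega
  obtain ⟨a, ha⟩ := h2
  have ha2 : ¬ (2 : ℤ) ∣ a := fun ⟨c, hc⟩ ↦ h4 ⟨c, by rw [ha, hc]; ring⟩
  have hmod : (d₀ * d₁) % 4 = 2 := by
    have h1 : a % 2 = 1 := by omega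
    have h3 : d₁ % 2 = 1 := by omega
    have : d₀ * d₁ = 4 * ((a / 2) * (2 * (d₁ / 2) + 1) + (d₁ / 2)) + 2 := by
      have ea : a = 2 * (a / 2) + 1 := by omega
      have ed : d₁ = 2 * (d₁ / 2) + 1 := by omega
      rw [ha]
      conv_lhs => rw [ea, ed]
      ring
    omega
  exact key.2 hmod

/-- **The `j`-family reduction with parity: odd inner twists suffice when `2⁶ ∤ N(W)` and the base is semistable at
`2`.** As `classAbsManinConstantEqOne_of_j_eq_of_certificates`, but the certificate is demanded only for ODD
square-free `d₀` supported on the primes of `2A`: an even `d₀` would give `f₂(W) = f₂(E₀ ⊗ d₀d₁) = 6`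
(`conductorExponent_two_quadraticTwist_eq_six_of_two_dvd`; the conductor exponent is an isomorphism invariant,
`conductorExponent_smul'`), contradicting `2⁶ ∤ N(W)`. [cite: BarriosEtAl2025, Thm. 5.1]
[cite: SilvermanAEC2009, X.5 Cor. 5.4] -/
theorem classAbsManinConstantEqOne_of_j_eq_of_odd_certificates
    (E₀ : WeierstrassCurve ℚ) [E₀.IsElliptic] (h0 : E₀.j ≠ 0) (h1728 : E₀.j ≠ 1728) (A : ℕ)
    (hf2 : ∀ v : HeightOneSpectrum ℤ, natGenerator v = 2 → E₀.conductorExponent v ≤ 1)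
    (hT : ∀ d₀ d₁ : ℤ, d₀ ≠ 0 → d₁ ≠ 0 → IsCoprime d₁ (2 * A * d₀) →
      ClassAbsManinConstantEqOne (E₀.quadraticTwist ((d₀ : ℤ) : ℚ)) →
      ClassAbsManinConstantEqOne (E₀.quadraticTwist ((-d₀ : ℤ) : ℚ)) →
      ClassAbsManinConstantEqOne (E₀.quadraticTwist ((d₀ * d₁ : ℤ) : ℚ)))
    (hcert : ∀ d₀ : ℤ, d₀ ≠ 0 → Squarefree d₀ → (∀ q : ℕ, q.Prime → (q : ℤ) ∣ d₀ → q ∣ 2 * A) →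
      ¬ (2 : ℤ) ∣ d₀ → ClassAbsManinConstantEqOne (E₀.quadraticTwist ((d₀ : ℤ) : ℚ)))
    (W : WeierstrassCurve ℚ) [W.IsElliptic] (hjW : W.j = E₀.j) (hN : ¬ 2 ^ 6 ∣ W.conductorNorm ℤ) :
    ClassAbsManinConstantEqOne W := by
  obtain ⟨d, hd0, C, hC⟩ := exists_variableChange_eq_quadraticTwist_of_j_eq hjW h0 h1728
  haveI := E₀.isElliptic_quadraticTwist hd0
  set D : ℤ := d.num * d.den with hDdef
  have hD0 : D ≠ 0 := mul_ne_zero (Rat.num_ne_zero.mpr hd0) (by exact_mod_cast d.den_nz)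
  have hdD : d * (d.den : ℚ) ^ 2 = ((D : ℤ) : ℚ) := by
    rw [hDdef]; push_cast; rw [sq, ← mul_assoc, Rat.mul_den_eq_num]
  have hden0 : (d.den : ℚ) ≠ 0 := by exact_mod_cast d.den_nz
  obtain ⟨C₁, hC₁⟩ := exists_variableChange_quadraticTwist_mul_sq E₀ d (d.den : ℚ) hden0
  rw [hdD] at hC₁
  haveI : (E₀.quadraticTwist ((D : ℤ) : ℚ)).IsElliptic := E₀.isElliptic_quadraticTwist (by exact_mod_cast hD0)
  obtain ⟨d₀, d₁, b, hb0, hd₀0, hd₁0, hsplit, hsq₀, hsupp, hcop⟩ := exists_squarefree_split D hD0 (2 * A)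
  have hd01 : ((d₀ * d₁ : ℤ) : ℚ) ≠ 0 := by exact_mod_cast mul_ne_zero hd₀0 hd₁0
  haveI : (E₀.quadraticTwist ((d₀ * d₁ : ℤ) : ℚ)).IsElliptic := E₀.isElliptic_quadraticTwist hd01
  have hcast : ((D : ℤ) : ℚ) = ((d₀ * d₁ : ℤ) : ℚ) * ((b : ℤ) : ℚ) ^ 2 := by rw [hsplit]; push_cast; ring
  obtain ⟨C₂, hC₂⟩ :=
    exists_variableChange_quadraticTwist_mul_sq E₀ ((d₀ * d₁ : ℤ) : ℚ) ((b : ℤ) : ℚ) (by exact_mod_cast hb0)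
  rw [← hcast] at hC₂
  have hcop' : IsCoprime d₁ (2 * (A : ℤ) * d₀) := by
    have : (2 * (A : ℤ) * d₀) = (((2 * A : ℕ) : ℤ) * d₀) := by push_cast; ring
    rw [this]; exact hcop
  -- `d₁` is odd
  have hd₁odd : ¬ (2 : ℤ) ∣ d₁ := fun h ↦ by
    have hu := hcop'.isUnit_of_dvd' h ⟨(A : ℤ) * d₀, by ring⟩
    rw [Int.isUnit_iff] at hu
    omega
  -- the parity of `d₀`: an even `d₀` forces `f₂(W) = 6`
  have hd₀odd : ¬ (2 : ℤ) ∣ d₀ := by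
    intro h2
    set v : HeightOneSpectrum ℤ := (primesEquiv (R := ℤ)).symm ⟨2, Nat.prime_two⟩ with hv
    have hgen : natGenerator v = 2 := congrArg Subtype.val ((primesEquiv (R := ℤ)).apply_symm_apply ⟨2, _⟩)
    haveI : PerfectField (IsLocalRing.ResidueField (v.adicCompletionIntegers ℚ)) := PerfectField.ofFinite
    have h6 : (E₀.quadraticTwist ((d₀ * d₁ : ℤ) : ℚ)).conductorExponent v = 6 :=
      conductorExponent_two_quadraticTwist_eq_six_of_two_dvd E₀ v hgen (hf2 v hgen) hsq₀ h2 hd₁odd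
    -- `f₂(W) = f₂(E₀ ⊗ d) = f₂(E₀ ⊗ D) = f₂(E₀ ⊗ d₀d₁) = 6`
    have hW6 : W.conductorExponent v = 6 := by
      rw [← conductorExponent_smul' v W C, hC, ← conductorExponent_smul' v _ C₁, hC₁, ← hC₂,
        conductorExponent_smul' v _ C₂, h6]
    apply hN
    have hN0 : W.conductorNorm ℤ ≠ 0 := (W.conductorNorm_pos_holds).ne'
    refine (Nat.prime_two.pow_dvd_iff_le_factorization hN0).mpr ?_
    have hfact := W.factorization_conductorNorm_holds v
    rw [hgen] at hfact
    rw [hfact, hW6]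
  -- conclude as in the parity-free reduction
  suffices h : ClassAbsManinConstantEqOne (E₀.quadraticTwist d) from
    h.of_isIsogenous (isIsogenous_of_smul_eq' hC)
  suffices h : ClassAbsManinConstantEqOne (E₀.quadraticTwist ((D : ℤ) : ℚ)) from
    h.of_isIsogenous (isIsogenous_of_smul_eq' hC₁)
  suffices h : ClassAbsManinConstantEqOne (E₀.quadraticTwist ((d₀ * d₁ : ℤ) : ℚ)) from
    h.of_isIsogenous (isIsogenous_of_smul_eq hC₂)
  refine hT d₀ d₁ hd₀0 hd₁0 hcop' (hcert d₀ hd₀0 hsq₀ hsupp hd₀odd) ?_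
  refine hcert (-d₀) (neg_ne_zero.mpr hd₀0) (hsq₀.squarefree_of_dvd ⟨-1, by ring⟩) (fun q hq hqd ↦ ?_)
    (fun h ↦ hd₀odd (dvd_neg.mp h))
  exact hsupp q hq (dvd_neg.mp hqd)

/-- **`j = −640320³` with `2⁶ ∤ N(W)` (base 26569a1 `[0,0,1,−2174420,1234136692]`, `Δ = −163³`; odd twists only,
`2⁴·163² = 425104 < 5·10⁵`).** Granted modularity, Cremona `≤ 5·10⁵` and the whole-family descent `hT` (item 25136).
[cite: CremonaAlgorithms1997, Table 1 (26569a1) and §3.8] [cite: BarriosEtAl2025, Thm. 5.1] -/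
theorem classAbsManinConstantEqOne_of_j_eq_neg_640320_cube (hnf : exists_isNewformOf)
    (hCre : cremona_abs_maninConstant_eq_one_of_level_le_500000)
    (hT : ∀ (E₀ : WeierstrassCurve ℚ) [E₀.IsElliptic] (A : ℕ),
      (∀ (q : ℕ) [Fact q.Prime], q ≠ 2 → Rank1Residual.Addv E₀ q → q ∣ A) →
      ∀ d₀ d₁ : ℤ, d₀ ≠ 0 → d₁ ≠ 0 → IsCoprime d₁ (2 * A * d₀) →
      ClassAbsManinConstantEqOne (E₀.quadraticTwist ((d₀ : ℤ) : ℚ)) →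
      ClassAbsManinConstantEqOne (E₀.quadraticTwist ((-d₀ : ℤ) : ℚ)) →
      ClassAbsManinConstantEqOne (E₀.quadraticTwist ((d₀ * d₁ : ℤ) : ℚ)))
    (W : WeierstrassCurve ℚ) [W.IsElliptic] (hj : W.j = -262537412640768000)
    (hN : ¬ 2 ^ 6 ∣ W.conductorNorm ℤ) : ClassAbsManinConstantEqOne W := by
  have hlt := cremona_abs_maninConstant_eq_one_of_level_lt_500000_of_le_500000 hCre
  have hΔ : (⟨0, 0, 1, -2174420, 1234136692⟩ : WeierstrassCurve ℤ).Δ = -((163 : ℤ) ^ 3) := by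
    norm_num [WeierstrassCurve.Δ, WeierstrassCurve.b₂, WeierstrassCurve.b₄, WeierstrassCurve.b₆, WeierstrassCurve.b₈]
  have hc₄ : (⟨0, 0, 1, -2174420, 1234136692⟩ : WeierstrassCurve ℤ).c₄ = 104372160 := by
    norm_num [WeierstrassCurve.c₄, WeierstrassCurve.b₂, WeierstrassCurve.b₄]
  haveI hE : ((⟨0, 0, 1, -2174420, 1234136692⟩ : WeierstrassCurve ℤ).baseChange ℚ).IsElliptic :=
    ⟨by rw [WeierstrassCurve.baseChange, WeierstrassCurve.map_Δ, hΔ]; norm_num⟩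
  set W₀ : WeierstrassCurve ℤ := ⟨0, 0, 1, -2174420, 1234136692⟩ with hW₀
  have hjb : (W₀.baseChange ℚ).j = -262537412640768000 := by
    rw [WeierstrassCurve.j, Units.val_inv_eq_inv_val, WeierstrassCurve.coe_Δ', WeierstrassCurve.baseChange,
      WeierstrassCurve.map_Δ, WeierstrassCurve.map_c₄, hΔ, hc₄]
    norm_num [eq_intCast]
  -- the primes of `Δ(W₀)` and of `2·163`
  have hΔq : ∀ q : ℕ, q.Prime → (q : ℤ) ∣ W₀.Δ → q = 163 := fun q hq h ↦ by
    rw [hΔ, dvd_neg] at h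
    have h' : q ∣ 163 ^ 3 := by exact_mod_cast h
    exact (Nat.prime_dvd_prime_iff_eq hq (by norm_num)).mp (hq.dvd_of_dvd_pow h')
  have h2A : ∀ q : ℕ, q.Prime → q ∣ 2 * 163 → q = 2 ∨ q = 163 := fun q hq h ↦ by
    rcases (Nat.Prime.dvd_mul hq).mp h with h | h
    · exact Or.inl ((Nat.prime_dvd_prime_iff_eq hq Nat.prime_two).mp h)
    · exact Or.inr ((Nat.prime_dvd_prime_iff_eq hq (by norm_num)).mp h)
  -- the base is good at `2`: `f₂ = 0`
  have hf2 : ∀ v : HeightOneSpectrum ℤ, natGenerator v = 2 → (W₀.baseChange ℚ).conductorExponent v ≤ 1 := by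
    intro v hv
    haveI : PerfectField (IsLocalRing.ResidueField (v.adicCompletionIntegers ℚ)) := PerfectField.ofFinite
    have hg : (W₀.baseChange ℚ).HasGoodReductionAt v :=
      Literature.NumberTheory.EllipticCurves.BurungaleSkinner2023.hasGoodReductionAt_baseChange_int_of_not_dvd W₀
        (fun h ↦ by have := hΔq _ (prime_natGenerator v) h; omega)
    rw [((W₀.baseChange ℚ).conductorExponent_eq_zero_iff_holds v).mpr hg]
    exact Nat.zero_le _
  refine classAbsManinConstantEqOne_of_j_eq_of_odd_certificates (W₀.baseChange ℚ) (by rw [hjb]; norm_num)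
    (by rw [hjb]; norm_num) 163 hf2 (hT _ 163 ?_) ?_ W (by rw [hjb, hj]) hN
  · -- the only odd bad prime of the base is `163`
    intro q _ hq2 hadd
    have hq : q.Prime := Fact.out
    by_cases hq163 : q = 163
    · rw [hq163]
    · exfalso
      exact hadd.1 (Literature.NumberTheory.EllipticCurves.BurungaleSkinner2023.hasGoodReductionAtPrime_baseChange_int_of_not_dvd
        W₀ (fun h ↦ hq163 (hΔq q hq h)))
  · -- the odd inner twists are in Cremona's range: `N ∣ 2⁴·163²`
    intro d₀ hd₀ hsq hsupp hodd
    have hd₀q : ((d₀ : ℤ) : ℚ) ≠ 0 := by exact_mod_cast hd₀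
    haveI := (W₀.baseChange ℚ).isElliptic_quadraticTwist hd₀q
    have hdvd : ((W₀.baseChange ℚ).quadraticTwist ((d₀ : ℤ) : ℚ)).conductorNorm ℤ ∣ 2 ^ 4 * 163 ^ 2 := by
      refine conductorNorm_dvd_of_good_outside_of_two_le _ {163} (by simp) ?_ 4
        (fun v hv ↦ conductorExponent_two_quadraticTwist_le_four_of_odd _ v hv (hf2 v hv) hd₀ hodd) _
        (by norm_num) (dvd_mul_right _ _) (by simp)
      intro q hq hq2 hqS
      haveI := Fact.mk hq
      have hq163 : q ≠ 163 := by simpa using hqS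
      have hnΔ : ¬ (q : ℤ) ∣ W₀.Δ := fun h ↦ hq163 (hΔq q hq h)
      have hnd : ¬ (q : ℤ) ∣ d₀ := fun h ↦ by
        rcases h2A q hq (hsupp q hq h) with h2' | h163
        · exact hq2 h2'
        · exact hq163 h163
      exact hasGoodReductionAtPrime_quadraticTwist_baseChange_int_of_not_dvd W₀ hq2 hnΔ hnd
    exact classAbsManinConstantEqOne_of_conductorNorm_lt_500000 hlt hnf _
      (lt_of_le_of_lt (Nat.le_of_dvd (by norm_num) hdvd) (by norm_num))

end Summit.BirchSwinnertonDyer.BirchSwinnertonDyer.Theorems.TwistFamilyManinDescent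

end
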